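import Mathlib
import Summits.NavierStokesRegularity.NavierStokesRegularity.Theorems.FilamentSkeletonRssStadiumPlateauLog
import Summits.NavierStokesRegularity.NavierStokesRegularity.Theorems.FilamentSkeletonRssStadiumContourPositivityAbs

/-!
# The plateau integral of the retyped contour is `O(log)` — in the stub's terms (`TangentSkeletonNearStraightL`, stmt-NavierStokesRegularity-23320,
# registered stub `stub_stripPropagation`; blueprint item R6′ of `DIAG-addendum2-landed-g2.md`)

For a target `z = τ + iy` ON its plateau (sources `σ + iy`, `σ ∈ [a,b] ∋ τ`; `n`-fold discs along the plateau and closed discs of radius `R₀` inside the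
stadium), horizontal pairs give `Re Q ≥ c(σ−τ)²` with `c = A₁ = 1 − (Rb + 2E)²/2` (Theorems.StadiumContourPositivityAbs, `Im((z−ζ)²) = 0`),
Theorems.StadiumPlateauKernel gives the pointwise majorant and Theorems.StadiumPlateauLog integrates it:
  `‖∫_a^b K(z, σ+iy) dσ‖ ≤ 4·M·(M/R₀)·(1/3 + log((b−a)√c/μ))/c^{3/2}`, `μ = √(κ/(2Λ))`, provided `μ/√c ≤ b − a`  (`plateau_norm_le`).
In the retype: `b − a = 2(L+8h)`, `R₀ = 7h`, `c ≥ 4/5` (Theorems.StadiumConstants), i.e. `O(log Γ/√Γ)` per unit circulation.  HONEST FRAMING: a tool for a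
HYPOTHETICAL filament skeleton on the NEGATIVE side of a MODEL route; nothing here bears on Navier–Stokes regularity or blow-up.
`--supports stmt-NavierStokesRegularity-23320`.
-/

set_option linter.dupNamespace false

noncomputable section

namespace Summit.NavierStokesRegularity.NavierStokesRegularity.Theorems.StadiumPlateauBound

open Set Metric MeasureTheory
open scoped InnerProductSpace Matrix
open Summit.NavierStokesRegularity.NavierStokesRegularity.Theorems.StadiumPlateauKernel
open Summit.NavierStokesRegularity.NavierStokesRegularity.Theorems.StadiumPlateauLog
open Summit.NavierStokesRegularity.NavierStokesRegularity.Theorems.StadiumContourPositivityAbs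

/-- **Plateau bound in the stub's terms.**  See the module docstring. [folklore] -/
theorem plateau_norm_le {hs L cc M Rb n κ Λ R₀ a b τ y : ℝ} {F : ℂ → (Fin 3 → ℂ)} {G : ℂ → ℂ}
    (hF : DifferentiableOn ℂ F {z : ℂ | |z.im| < hs ∧ |z.re - cc| < L + hs})
    (hunit : ∀ w ∈ {z : ℂ | |z.im| < hs ∧ |z.re - cc| < L + hs}, ∑ i, (deriv F w i) ^ 2 = 1)
    (hM : ∀ z ∈ {z : ℂ | |z.im| < hs ∧ |z.re - cc| < L + hs}, ‖deriv F z‖ ≤ M)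
    {X : ℝ → EuclideanSpace ℝ (Fin 3)} (hX : Differentiable ℝ X) (hXu : ∀ τ, ‖deriv X τ‖ = 1)
    (hosc : ∀ τ σ, ‖deriv X τ - deriv X σ‖ ≤ Rb)
    (hFX : ∀ r : ℝ, (r : ℂ) ∈ {z : ℂ | |z.im| < hs ∧ |z.re - cc| < L + hs} →
      F r = fun i => ((⟪X r, EuclideanSpace.single i (1:ℝ)⟫_ℝ : ℝ) : ℂ))
    (hGre : ∀ w ∈ {z : ℂ | |z.im| < hs ∧ |z.re - cc| < L + hs}, Λ⁻¹ / 2 ≤ (G w).re)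
    (hn : 1 < n) (hκ : 0 < κ) (hΛ : 0 < Λ) (hR₀ : 0 < R₀) (hab : a ≤ b) (hτ : τ ∈ Icc a b)
    (hfit : n * |y| < hs) (hfit' : ∀ σ ∈ Icc a b, |σ - cc| + n * |y| < L + hs)
    (hdisc : ∀ σ ∈ Set.uIcc a b, closedBall ((σ : ℂ) + (y : ℂ) * Complex.I) R₀ ⊆ {z : ℂ | |z.im| < hs ∧ |z.re - cc| < L + hs})
    (hc : 0 < 1 - (Rb + 2 * (√3 * (2 * M * (Real.log (n / (n - 1)) - 1 / n)))) ^ 2 / 2)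
    (hR : √(κ / (2 * Λ)) / √(1 - (Rb + 2 * (√3 * (2 * M * (Real.log (n / (n - 1)) - 1 / n)))) ^ 2 / 2) ≤ b - a) :
    ‖∫ σ in a..b, (((∑ i, (F ((τ : ℂ) + (y : ℂ) * Complex.I) i - F ((σ : ℂ) + (y : ℂ) * Complex.I) i) ^ 2) +
          (κ : ℂ) * G ((σ : ℂ) + (y : ℂ) * Complex.I)) ^ ((3:ℂ) / 2))⁻¹ •
        (deriv F ((σ : ℂ) + (y : ℂ) * Complex.I) ⨯₃
          (fun i => F ((τ : ℂ) + (y : ℂ) * Complex.I) i - F ((σ : ℂ) + (y : ℂ) * Complex.I) i))‖ ≤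
      4 * (M * (M / R₀)) * ((1/3 + Real.log ((b - a) * √(1 - (Rb + 2 * (√3 * (2 * M * (Real.log (n / (n - 1)) - 1 / n)))) ^ 2 / 2) /
        √(κ / (2 * Λ)))) / (1 - (Rb + 2 * (√3 * (2 * M * (Real.log (n / (n - 1)) - 1 / n)))) ^ 2 / 2) ^ (3/2 : ℝ)) := by
  set S : Set ℂ := {z : ℂ | |z.im| < hs ∧ |z.re - cc| < L + hs} with hS
  have hSo : IsOpen S := by
    have h1 : IsOpen {z : ℂ | |z.im| < hs} := isOpen_lt (continuous_abs.comp Complex.continuous_im) continuous_const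
    have h2 : IsOpen {z : ℂ | |z.re - cc| < L + hs} :=
      isOpen_lt (continuous_abs.comp (Complex.continuous_re.sub continuous_const)) continuous_const
    exact h1.inter h2
  set c : ℝ := 1 - (Rb + 2 * (√3 * (2 * M * (Real.log (n / (n - 1)) - 1 / n)))) ^ 2 / 2 with hcdef
  set μ : ℝ := √(κ / (2 * Λ)) with hμdef
  have hμpos : 0 < μ := Real.sqrt_pos.2 (by positivity)
  have hμsq : μ ^ 2 = κ / (2 * Λ) := Real.sq_sqrt (by positivity)
  set z : ℂ := (τ : ℂ) + (y : ℂ) * Complex.I with hz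
  have huIcc : Set.uIcc a b = Icc a b := uIcc_of_le hab
  have hM0 : 0 ≤ M := (norm_nonneg _).trans (hM _ (hdisc a (by rw [huIcc]; exact left_mem_Icc.2 hab) (mem_closedBall_self hR₀.le)))
  -- pointwise majorant along the plateau
  have hdom : ∀ σ ∈ Icc a b, ‖(((∑ i, (F z i - F ((σ : ℂ) + (y : ℂ) * Complex.I) i) ^ 2) +
          (κ : ℂ) * G ((σ : ℂ) + (y : ℂ) * Complex.I)) ^ ((3:ℂ) / 2))⁻¹ •
        (deriv F ((σ : ℂ) + (y : ℂ) * Complex.I) ⨯₃ (fun i => F z i - F ((σ : ℂ) + (y : ℂ) * Complex.I) i))‖ ≤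
      (c * (σ - τ) ^ 2 + μ ^ 2) ^ (-(3/2 : ℝ)) * (2 * M * (M / R₀) * (σ - τ) ^ 2) := by
    intro σ hσ
    set ζ : ℂ := (σ : ℂ) + (y : ℂ) * Complex.I with hζ
    have hζeq : z + ((σ - τ : ℝ) : ℂ) = ζ := by simp [hz, hζ]; ring
    -- horizontal pair: `Re Q ≥ c (σ−τ)²`
    have hzim : z.im = y := by simp [hz]
    have hζim : ζ.im = y := by simp [hζ]
    have hzre : z.re = τ := by simp [hz]
    have hζre : ζ.re = σ := by simp [hζ]
    have hs2re : ((z - ζ) ^ 2).re = (σ - τ) ^ 2 := by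
      rw [sq, Complex.mul_re, Complex.sub_re, Complex.sub_im, hzim, hζim, hzre, hζre]; ring
    have hs2im : ((z - ζ) ^ 2).im = 0 := by
      rw [sq, Complex.mul_im, Complex.sub_re, Complex.sub_im, hzim, hζim]; ring
    have hpair := pair_chord_re_ge_abs hF hunit hM hX hXu hosc hFX hn (z := z) (ζ := ζ)
      (by rw [hzim]; exact hfit) (by rw [hzim, hzre]; exact hfit' τ hτ) (by rw [hζim]; exact hfit)
      (by rw [hζim, hζre]; exact hfit' σ hσ) (by rw [hs2re]; positivity)
    rw [hs2re, hs2im, abs_zero, zero_mul, sub_zero, ← hcdef] at hpair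
    -- reorder the squares to the orientation of `plateau_kernel_norm_le`
    have hQ : c * (σ - τ) ^ 2 ≤ (∑ i, (F (z + ((σ - τ : ℝ) : ℂ)) i - F z i) ^ 2).re := by
      rw [hζeq]
      have e : (∑ i, (F ζ i - F z i) ^ 2) = ∑ i, (F z i - F ζ i) ^ 2 := Finset.sum_congr rfl fun i _ => by ring
      rw [e]; linarith
    have hτ' : τ ∈ Set.uIcc a b := by rw [huIcc]; exact hτ
    have hσ' : σ ∈ Set.uIcc a b := by rw [huIcc]; exact hσ
    have hk := plateau_kernel_norm_le hSo hF hM hR₀ hdisc hτ' hσ' hκ hΛ (le_refl Λ⁻¹) hc.le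
      (hGre _ (hdisc σ hσ' (mem_closedBall_self hR₀.le))) hQ
    rw [hζeq] at hk
    have e1 : (∑ i, (F ζ i - F z i) ^ 2) = ∑ i, (F z i - F ζ i) ^ 2 := Finset.sum_congr rfl fun i _ => by ring
    have e2 : (F z - F ζ) = fun i => F z i - F ζ i := by funext i; simp [Pi.sub_apply]
    rw [e1, e2] at hk
    have e3 : κ / (2 * Λ) = μ ^ 2 := hμsq.symm
    rw [e3] at hk
    exact hk
  have hBK : 0 ≤ M * (M / R₀) := by positivity
  have h := plateau_integral_norm_le (E := Fin 3 → ℂ) hab hτ hc hμpos hR hBK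
    (f := fun σ => (((∑ i, (F z i - F ((σ : ℂ) + (y : ℂ) * Complex.I) i) ^ 2) +
          (κ : ℂ) * G ((σ : ℂ) + (y : ℂ) * Complex.I)) ^ ((3:ℂ) / 2))⁻¹ •
        (deriv F ((σ : ℂ) + (y : ℂ) * Complex.I) ⨯₃ (fun i => F z i - F ((σ : ℂ) + (y : ℂ) * Complex.I) i)))
    (fun σ hσ => by
      have := hdom σ hσ
      have e : 2 * M * (M / R₀) * (σ - τ) ^ 2 = 2 * M * (M / R₀) * (σ - τ) ^ 2 := rfl
      simpa [mul_assoc] using this)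
  simpa [hz] using h

end Summit.NavierStokesRegularity.NavierStokesRegularity.Theorems.StadiumPlateauBound

end
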